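import Summits.QuantumFields.BalabanUV.Beta.EriceRemainderEnclosureHistoryAutonomyComparisonAgeCompositionYoungPairTower10
import Summits.QuantumFields.BalabanUV.Beta.EriceRemainderEnclosureHistoryAutonomyComparisonAgeCompositionYoungSingletonTower10Ratio10
import Summits.QuantumFields.BalabanUV.Beta.EriceRemainderEnclosureHistoryAutonomyComparisonAgeCompositionTower10Every

/-!
# EriceRemainderEnclosureHistoryAutonomyComparisonAgeCompositionTwoYoungestFree — (E110e) route (N), first order: THE TWO YOUNGEST AGES ARE FREE.
# The union of the ratio-10 tower theorems after (E110a–d, f).  TWO STATEMENTS, each for EVERY youngest age `a_0 ≥ 1` and ANY number `r` of ages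
# `a_0 < a_1 < … < a_{r−1}` (`< K`, the profile vanishing off them), `0 ≤ ε ≤ e` at every pin along every admissible flow, every horizon, every damping of
# the self-consistent class:
# * **`flow_nonneg_tower10_old_second`** — «RATIO TEN THROUGHOUT, SECOND AGE OLD»: `a_1 ≥ 58` and EVERY consecutive ratio `a_{j+1} ≥ 10a_j` (`j ≥ 0`)
#   (`a_0 = 1`: (E109d) `flow_nonneg_census_tower10`; `a_0 ≥ 2`: (E110f) `flow_nonneg_young_singleton_tower10`);
# * **`flow_nonneg_tower10_two_youngest_free`** — «THE TWO YOUNGEST AGES ARE FREE»: EVERY `a_1 > a_0`, then `a_2 ≥ 58a_1` and `a_{j+1} ≥ 10a_j` (`j ≥ 2`)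
#   (`a_0 = 1`: (E109f) `flow_nonneg_census_tower10_every`; `a_0 ≥ 2`, `a_1 ≤ 58a_0`: (E110d) `flow_nonneg_young_pair_old_tower10`, young-pair cap `0.86`;
#   `a_0 ≥ 2`, `a_1 > 58a_0`: (E110f)).
# So along the tower axis of the census the `58` survives in exactly one place: between a YOUNG second age (`a_1 ≤ 57`, or `a_1 < 10a_0`) and the third.
# BEFORE this generation the youngest age had to be `1` (census towers (E106)–(E109)) or `≥ 58` (old towers (E109g)), a young second age had to sit over
# `a_0 = 1`, and (E96) allowed an arbitrary `a_0` only under `a_1 ≥ 30a_0` followed by a `×61` chain.  CENSUS COROLLARIES (four ages `{k₁<k₂<k₃<k₄}`):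
# **`flow_nonneg_four_ages_two_youngest_free`** (EVERY `k₁`, EVERY `k₂`, `k₃ ≥ 58k₂`, `k₄ ≥ 10k₃`) and **`flow_nonneg_four_ages_ratio10_old_second`**
# (EVERY `k₁`, `k₂ ≥ max(10k₁, 58)`, `k₃ ≥ 10k₂`, `k₄ ≥ 10k₃`).

Cell `pub-balaban`, β-function sub-cell, BINDER row D4 «RemainderConst leaves for Bałaban's split» (`HOME/BINDER-OWNERS.md`; owner lineage `b2b-balaban-beta-an4`;
this file by co-owner #2 lineage `b2b-balaban-beta-d4-p2`, generation 91), β-FLOW TEAM duty (1), FREEZE (0) honoured (def-free; nothing restated).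

HONEST FRAMING (page 1, verbatim and binding).  *"Discharging BetaPertH makes Bałaban's UV stability UNCONDITIONAL — a real constructive-QFT result; it is
NOT the continuum limit and NOT the Clay problem."*  THIS FILE DISCHARGES NOTHING OF THE KIND.  Elementary real algebra ∕ real analysis about ABSTRACT
functionals on a box ]0,γ]^ℕ with displayed floors, profiles and signs, and the FIRST-ORDER renewal objects of route (N) built from them — hypotheses of a
census, not facts; the form, signs, ages and moments of Bałaban's (1.22) limit functional are NOT PRINTED ([I] p. 298; GAPS G-t4-U2-1∕-2) and NOT asserted.
Row D4 class UNCHANGED (critical-path width 0; instance 0∕1; D4 DISCHARGE NO DATE).  HONEST DEPENDENCY: continuum YM on T⁴ ⇐ BetaPertH ∧ nine spine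
estimates (0/9 proved); BetaPertH ⇐ (D1) ∧ (D4) ∧ CAP+tail; G-an2-4 gates asym, D1 and NE2/3/4.

THE POINT (README `HOME/b2b-balaban-beta-d4-p2/g91/README.md` §1).  Uses (E110d) `flow_nonneg_young_pair_old_tower10`, (E110f) `flow_nonneg_young_singleton_tower10`,
(E109d) `flow_nonneg_census_tower10`, (E109f) `flow_nonneg_census_tower10_every` BY NAME.  NOT CLAIMED: `a_2 < 58a_1` over a young second age; ratios below 10;
anything printed — NOT B12 Thm 2, NOT BetaPertH, NOT continuum, NOT Clay.

WHAT IS PROVED ([folklore]; 0 `def`, 0 sorry).  §1 **`flow_nonneg_tower10_old_second`**, §2 **`flow_nonneg_tower10_two_youngest_free`**, §3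
**`flow_nonneg_four_ages_ratio10_old_second`**, **`flow_nonneg_four_ages_two_youngest_free`**.
-/
noncomputable section
open Finset

namespace Summit.QuantumFields.BalabanUV.Beta.EriceRemainderEnclosureHistoryAutonomyComparisonAgeCompositionTwoYoungestFree

open Literature.MathematicalPhysics.QuantumFieldTheory.Balaban1983to89
open Literature.MathematicalPhysics.QuantumFieldTheory.Balaban1983to89.T4BetaStationary
open Literature.MathematicalPhysics.QuantumFieldTheory.Balaban1983to89.T4BetaFlowWellPosed
open Summit.QuantumFields.BalabanUV.Beta.EriceRemainderEnclosureHistoryAutonomyComparisonAgeCompositionYoungPairTower10 (flow_nonneg_young_pair_old_tower10)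
open Summit.QuantumFields.BalabanUV.Beta.EriceRemainderEnclosureHistoryAutonomyComparisonAgeCompositionYoungSingletonTower10Ratio10 (flow_nonneg_young_singleton_tower10)
open Summit.QuantumFields.BalabanUV.Beta.EriceRemainderEnclosureHistoryAutonomyComparisonAgeCompositionTower10 (flow_nonneg_census_tower10)
open Summit.QuantumFields.BalabanUV.Beta.EriceRemainderEnclosureHistoryAutonomyComparisonAgeCompositionTower10Every (flow_nonneg_census_tower10_every)

variable {B : (ℕ → ℝ) → ℝ} {γ b gIR : ℝ} {L : ℕ → ℝ} {K : ℕ} {h g : ℕ → ℝ}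

/-! ## §1 Ratio ten throughout, second age old -/

/-- **RATIO TEN THROUGHOUT, SECOND AGE OLD — EVERY YOUNGEST AGE.**  `B` an isotone memory with floor `b > 0` dominating the profile `L ≥ 0`, `h` a box solution,
`g` a damping of the self-consistent class, the route-(N) renewal objects, `e ≥ 0` non-increasing, `ε` the zero-tailed solution.  Ages `a_0 < a_1 < … < a_{r−1}`
(`r ≥ 1`) with `1 ≤ a_0` (ANY), `58 ≤ a_1`, `10a_j ≤ a_{j+1}` for EVERY `j`, all `< K`, the profile vanishing off them.  THEN `0 ≤ ε ≤ e` at every pin. [folklore] -/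
theorem flow_nonneg_tower10_old_second
    (hmono : ∀ u v : ℕ → ℝ, SeqBox γ u → SeqBox γ v → (∀ j, u j ≤ v j) → B u ≤ B v)
    (hL : ∀ k, 0 ≤ L k) (hb : 0 < b) (hlo : ∀ u, SeqBox γ u → b ≤ B u) (hdom : ∀ u, SeqBox γ u → ∑ k ∈ range K, L k * u k ≤ B u)
    (hh : SeqBox γ h) (hf : MemFlow B gIR h) (hg : ∀ t, 0 < g t ∧ g t ≤ 1)
    (hgF : ∀ t, 1 ≤ g t * (1 + ∑ k ∈ range K, L k * h (t + k) ^ 3 / 2))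
    {r : ℕ} {a : ℕ → ℕ} (hr : 1 ≤ r) (ha0 : 1 ≤ a 0) (ha1 : 1 < r → 58 ≤ a 1)
    (haR : ∀ j, j + 1 < r → 10 * a j ≤ a (j + 1)) (haK : ∀ j, j < r → a j < K)
    (hLa : ∀ l, l < K → (∀ j, j < r → l ≠ a j) → L l = 0)
    {N : ℕ} {KL : ℕ → ℕ → ℕ → ℝ}
    (hKL : ∀ k n l, KL k n l = if 0 < k ∧ k < K ∧ l < k then L k * h (n + k) ^ 3 / 2 * ∏ t ∈ Ico (n + 1 + l) (n + k + 1), g t else 0)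
    {KA : ℕ → ℕ → ℕ → ℝ} {RA : ℕ → (ℕ → ℝ) → ℕ → ℝ}
    (hRA : ∀ i v m, RA i v m = ∑ l ∈ range K, KA i m l * v (m + 1 + l))
    (hKA : ∀ i m l, KA i m l = KL i m l + KA (i + 1) m l) (hKAtop : ∀ m l, KA K m l = 0)
    {e ε : ℕ → ℝ} (he0 : ∀ m, 0 ≤ e m) (hea : ∀ m, e (m + 1) ≤ e m)
    (hεt : ∀ m, N < m → ε m = 0) (hεrec : ∀ m, ε m = e m - RA 1 ε m) : ∀ m, 0 ≤ ε m ∧ ε m ≤ e m := by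
  rcases Nat.lt_or_ge 1 (a 0) with h2 | h2
  · exact flow_nonneg_young_singleton_tower10 hmono hL hb hlo hdom hh hf hg hgF hr h2 ha1 haR haK hLa hKL hRA hKA hKAtop he0 hea hεt hεrec
  · exact flow_nonneg_census_tower10 hmono hL hb hlo hdom hh hf hg hgF hr (by omega) ha1 (fun j _ hjr => haR j hjr) haK hLa hKL hRA hKA hKAtop
      he0 hea hεt hεrec

/-! ## §2 The two youngest ages are free -/

/-- **THE TWO YOUNGEST AGES ARE FREE.**  Same objects; ages `a_0 < a_1 < … < a_{r−1}` (`r ≥ 1`) with `1 ≤ a_0` (ANY), `a_0 < a_1` (ANY), `58a_1 ≤ a_2`,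
`10a_j ≤ a_{j+1}` (`j ≥ 2`), all `< K`, the profile vanishing off them.  THEN `0 ≤ ε ≤ e` at every pin. [folklore] -/
theorem flow_nonneg_tower10_two_youngest_free
    (hmono : ∀ u v : ℕ → ℝ, SeqBox γ u → SeqBox γ v → (∀ j, u j ≤ v j) → B u ≤ B v)
    (hL : ∀ k, 0 ≤ L k) (hb : 0 < b) (hlo : ∀ u, SeqBox γ u → b ≤ B u) (hdom : ∀ u, SeqBox γ u → ∑ k ∈ range K, L k * u k ≤ B u)
    (hh : SeqBox γ h) (hf : MemFlow B gIR h) (hg : ∀ t, 0 < g t ∧ g t ≤ 1)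
    (hgF : ∀ t, 1 ≤ g t * (1 + ∑ k ∈ range K, L k * h (t + k) ^ 3 / 2))
    {r : ℕ} {a : ℕ → ℕ} (hr : 1 ≤ r) (ha0 : 1 ≤ a 0) (ha01 : 1 < r → a 0 < a 1) (ha2 : 2 < r → 58 * a 1 ≤ a 2)
    (haR : ∀ j, 2 ≤ j → j + 1 < r → 10 * a j ≤ a (j + 1)) (haK : ∀ j, j < r → a j < K)
    (hLa : ∀ l, l < K → (∀ j, j < r → l ≠ a j) → L l = 0)
    {N : ℕ} {KL : ℕ → ℕ → ℕ → ℝ}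
    (hKL : ∀ k n l, KL k n l = if 0 < k ∧ k < K ∧ l < k then L k * h (n + k) ^ 3 / 2 * ∏ t ∈ Ico (n + 1 + l) (n + k + 1), g t else 0)
    {KA : ℕ → ℕ → ℕ → ℝ} {RA : ℕ → (ℕ → ℝ) → ℕ → ℝ}
    (hRA : ∀ i v m, RA i v m = ∑ l ∈ range K, KA i m l * v (m + 1 + l))
    (hKA : ∀ i m l, KA i m l = KL i m l + KA (i + 1) m l) (hKAtop : ∀ m l, KA K m l = 0)
    {e ε : ℕ → ℝ} (he0 : ∀ m, 0 ≤ e m) (hea : ∀ m, e (m + 1) ≤ e m)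
    (hεt : ∀ m, N < m → ε m = 0) (hεrec : ∀ m, ε m = e m - RA 1 ε m) : ∀ m, 0 ≤ ε m ∧ ε m ≤ e m := by
  rcases Nat.lt_or_ge 1 (a 0) with h2 | h2
  · -- a_0 ≥ 2
    rcases Nat.lt_or_ge 1 r with h1r | h1r
    · rcases le_or_gt (a 1) (58 * a 0) with hnear | hfar
      · -- the young pair {a_0, a_1} under the tower
        exact flow_nonneg_young_pair_old_tower10 hmono hL hb hlo hdom hh hf hg hgF h1r h2 (ha01 h1r) hnear ha2 haR haK hLa hKL hRA hKA hKAtop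
          he0 hea hεt hεrec
      · -- a_1 > 58a_0: an old second age at ratio ≥ 10 — the young singleton under the tower
        refine flow_nonneg_young_singleton_tower10 hmono hL hb hlo hdom hh hf hg hgF hr h2 (fun _ => by omega) (fun j hjr => ?_) haK hLa hKL hRA
          hKA hKAtop he0 hea hεt hεrec
        rcases Nat.lt_or_ge j 2 with hj2 | hj2
        · interval_cases j
          · show 10 * a 0 ≤ a 1; omega
          · show 10 * a 1 ≤ a 2; have := ha2 hjr; omega
        · exact haR j hj2 hjr
    · -- a lone age
      exact flow_nonneg_young_singleton_tower10 hmono hL hb hlo hdom hh hf hg hgF hr h2 (fun h => absurd h (by omega))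
        (fun j hjr => absurd hjr (by omega)) haK hLa hKL hRA hKA hKAtop he0 hea hεt hεrec
  · -- a_0 = 1: the census tower for every second age
    exact flow_nonneg_census_tower10_every hmono hL hb hlo hdom hh hf hg hgF hr (by omega) (fun h1r => by have := ha01 h1r; omega) ha2 haR haK hLa
      hKL hRA hKA hKAtop he0 hea hεt hεrec

/-! ## §3 Census corollaries: four ages -/

/-- **FOUR AGES AT RATIO TEN, SECOND AGE OLD.**  Ages `1 ≤ k₁` (ANY), `k₂ ≥ 58`, `k₂ ≥ 10k₁`, `k₃ ≥ 10k₂`, `k₄ ≥ 10k₃`, `k₄ < K`, the profile vanishing off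
them: `0 ≤ ε ≤ e` at every pin. [folklore] -/
theorem flow_nonneg_four_ages_ratio10_old_second
    (hmono : ∀ u v : ℕ → ℝ, SeqBox γ u → SeqBox γ v → (∀ j, u j ≤ v j) → B u ≤ B v)
    (hL : ∀ k, 0 ≤ L k) (hb : 0 < b) (hlo : ∀ u, SeqBox γ u → b ≤ B u) (hdom : ∀ u, SeqBox γ u → ∑ k ∈ range K, L k * u k ≤ B u)
    (hh : SeqBox γ h) (hf : MemFlow B gIR h) (hg : ∀ t, 0 < g t ∧ g t ≤ 1)
    (hgF : ∀ t, 1 ≤ g t * (1 + ∑ k ∈ range K, L k * h (t + k) ^ 3 / 2))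
    {k₁ k₂ k₃ k₄ : ℕ} (hk1 : 1 ≤ k₁) (hk2 : 58 ≤ k₂) (hk12 : 10 * k₁ ≤ k₂) (hk3 : 10 * k₂ ≤ k₃) (hk4 : 10 * k₃ ≤ k₄) (hk4K : k₄ < K)
    (hL4 : ∀ j, j < K → j ≠ k₁ → j ≠ k₂ → j ≠ k₃ → j ≠ k₄ → L j = 0)
    {N : ℕ} {KL : ℕ → ℕ → ℕ → ℝ}
    (hKL : ∀ k n l, KL k n l = if 0 < k ∧ k < K ∧ l < k then L k * h (n + k) ^ 3 / 2 * ∏ t ∈ Ico (n + 1 + l) (n + k + 1), g t else 0)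
    {KA : ℕ → ℕ → ℕ → ℝ} {RA : ℕ → (ℕ → ℝ) → ℕ → ℝ}
    (hRA : ∀ i v m, RA i v m = ∑ l ∈ range K, KA i m l * v (m + 1 + l))
    (hKA : ∀ i m l, KA i m l = KL i m l + KA (i + 1) m l) (hKAtop : ∀ m l, KA K m l = 0)
    {e ε : ℕ → ℝ} (he0 : ∀ m, 0 ≤ e m) (hea : ∀ m, e (m + 1) ≤ e m)
    (hεt : ∀ m, N < m → ε m = 0) (hεrec : ∀ m, ε m = e m - RA 1 ε m) : ∀ m, 0 ≤ ε m ∧ ε m ≤ e m := by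
  refine flow_nonneg_tower10_old_second hmono hL hb hlo hdom hh hf hg hgF (r := 4)
    (a := fun j => if j = 0 then k₁ else if j = 1 then k₂ else if j = 2 then k₃ else k₄) (by norm_num) (by simpa using hk1) (fun _ => by simpa using hk2)
    (fun j hjr => ?_) (fun j hj => ?_) (fun l hl hla => hL4 l hl ?_ ?_ ?_ ?_) hKL hRA hKA hKAtop he0 hea hεt hεrec
  · have : j = 0 ∨ j = 1 ∨ j = 2 := by omega
    rcases this with rfl | rfl | rfl <;> simpa
  · have : j = 0 ∨ j = 1 ∨ j = 2 ∨ j = 3 := by omega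
    rcases this with rfl | rfl | rfl | rfl <;> simp <;> omega
  · simpa using hla 0 (by norm_num)
  · simpa using hla 1 (by norm_num)
  · simpa using hla 2 (by norm_num)
  · simpa using hla 3 (by norm_num)

/-- **FOUR AGES, THE TWO YOUNGEST FREE.**  Ages `1 ≤ k₁ < k₂` (BOTH otherwise arbitrary), `k₃ ≥ 58k₂`, `k₄ ≥ 10k₃`, `k₄ < K`, the profile vanishing off them:
`0 ≤ ε ≤ e` at every pin. [folklore] -/
theorem flow_nonneg_four_ages_two_youngest_free
    (hmono : ∀ u v : ℕ → ℝ, SeqBox γ u → SeqBox γ v → (∀ j, u j ≤ v j) → B u ≤ B v)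
    (hL : ∀ k, 0 ≤ L k) (hb : 0 < b) (hlo : ∀ u, SeqBox γ u → b ≤ B u) (hdom : ∀ u, SeqBox γ u → ∑ k ∈ range K, L k * u k ≤ B u)
    (hh : SeqBox γ h) (hf : MemFlow B gIR h) (hg : ∀ t, 0 < g t ∧ g t ≤ 1)
    (hgF : ∀ t, 1 ≤ g t * (1 + ∑ k ∈ range K, L k * h (t + k) ^ 3 / 2))
    {k₁ k₂ k₃ k₄ : ℕ} (hk1 : 1 ≤ k₁) (hk12 : k₁ < k₂) (hk3 : 58 * k₂ ≤ k₃) (hk4 : 10 * k₃ ≤ k₄) (hk4K : k₄ < K)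
    (hL4 : ∀ j, j < K → j ≠ k₁ → j ≠ k₂ → j ≠ k₃ → j ≠ k₄ → L j = 0)
    {N : ℕ} {KL : ℕ → ℕ → ℕ → ℝ}
    (hKL : ∀ k n l, KL k n l = if 0 < k ∧ k < K ∧ l < k then L k * h (n + k) ^ 3 / 2 * ∏ t ∈ Ico (n + 1 + l) (n + k + 1), g t else 0)
    {KA : ℕ → ℕ → ℕ → ℝ} {RA : ℕ → (ℕ → ℝ) → ℕ → ℝ}
    (hRA : ∀ i v m, RA i v m = ∑ l ∈ range K, KA i m l * v (m + 1 + l))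
    (hKA : ∀ i m l, KA i m l = KL i m l + KA (i + 1) m l) (hKAtop : ∀ m l, KA K m l = 0)
    {e ε : ℕ → ℝ} (he0 : ∀ m, 0 ≤ e m) (hea : ∀ m, e (m + 1) ≤ e m)
    (hεt : ∀ m, N < m → ε m = 0) (hεrec : ∀ m, ε m = e m - RA 1 ε m) : ∀ m, 0 ≤ ε m ∧ ε m ≤ e m := by
  refine flow_nonneg_tower10_two_youngest_free hmono hL hb hlo hdom hh hf hg hgF (r := 4)
    (a := fun j => if j = 0 then k₁ else if j = 1 then k₂ else if j = 2 then k₃ else k₄) (by norm_num) (by simpa using hk1) (fun _ => by simpa using hk12)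
    (fun _ => by simpa using hk3) (fun j hj hjr => ?_) (fun j hj => ?_) (fun l hl hla => hL4 l hl ?_ ?_ ?_ ?_) hKL hRA hKA hKAtop he0 hea hεt hεrec
  · have : j = 2 := by omega
    subst this; simpa using hk4
  · have : j = 0 ∨ j = 1 ∨ j = 2 ∨ j = 3 := by omega
    rcases this with rfl | rfl | rfl | rfl <;> simp <;> omega
  · simpa using hla 0 (by norm_num)
  · simpa using hla 1 (by norm_num)
  · simpa using hla 2 (by norm_num)
  · simpa using hla 3 (by norm_num)

end Summit.QuantumFields.BalabanUV.Beta.EriceRemainderEnclosureHistoryAutonomyComparisonAgeCompositionTwoYoungestFree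

end
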